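import Summits.Ventures.Crystal3D.Theorems.StickyWulffConstantCoaxialWallLawOnSiteDominateMenu
import HarnessLib

/-!
# The on-site DOMINATION under the abstract neighbour menu, II: twin systems
# (crux `CoaxialWallLaw`, stmt-Ventures-19481, line `WallLedgerF`; re-base of `…OnSiteDominate` for 𝒰_cx)

HONEST FRAMING. Venture `Summits/Ventures/Crystal3D` (cell `crystal3d-full`), helper `--supports` the crux
`CoaxialWallLaw` (stmt-Ventures-19481, `route-Ventures-StickyWulffConstant`), REGISTERED line `WallLedgerF` (planner
cf-p1, decision (lxii), 𝒰_cx = `coaxialModuleUniverse`).  Rung credit; F-C1 not moved; census-free.  Part I is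
`…OnSiteDominateMenu` (hypothesis `hW`: the eighteen-vector neighbour menu on a set `W ⊇` the window).
* **`dominate_twin_of_roots_menu`**, **`dominate_twin_menu`** — the landed proofs under `hW`;
* NEW packaging for the bridge: **`exists_twinSig_bound_menu`** — at a window congruent to a pattern `P ⊆ W`, for ANY
  frame `L`, the typed twin summand (half-turn form) is bounded by `localStatSig P v (transSigs ε n) 0` for some model
  normal `n` or by `localStatSig P v (twinSigs ε h) 0` for some basal slot `h`.
WHAT THIS IS NOT: not the 𝒰_cx bridge/capstone (next file), not the tail; F-C1 not moved.
-/

noncomputable section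

namespace Summit.Ventures.Crystal3D.Theorems

open Summit.Ventures.Crystal3D Finset
open Literature.MathematicalPhysics.StatisticalMechanics (basalMirror basalMirror_apply_coord basalMirror_basalMirror)
open scoped InnerProductSpace

section Dominate

variable {v : WordVersion} {Y : Finset (EuclideanSpace ℝ (Fin 3))} {W : Set (EuclideanSpace ℝ (Fin 3))}

/-- **DOMINATION FOR ROOT-ONLY TWIN SYSTEMS** (a basal-axis base frame `L′` and its half-turn companion whose standard
classes are all root classes): every (A)-end pair near the payer is a signature pair of `twinSigs ε h` for ONE basal
slot `h` — the landed proof, under the neighbour-menu hypothesis `hW` on a set `W ⊇` the window. -/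
theorem dominate_twin_of_roots_menu (hW : ∀ q ∈ W, ∀ x ∈ W, dist q x = 1 →
      x - q ∈ fccSlots ∨ x - q ∈ (basalMirror : EuclideanSpace ℝ (Fin 3) → EuclideanSpace ℝ (Fin 3)) '' ↑fccSlots)
    (hY : ∀ x ∈ Y, dist (0 : EuclideanSpace ℝ (Fin 3)) x ≤ 3 → x ∈ W)
    (L' : EuclideanSpace ℝ (Fin 3) ≃ₗᵢ[ℝ] EuclideanSpace ℝ (Fin 3))
    (R : Finset (EuclideanSpace ℝ (Fin 3))) (hR : R ⊆ basalHexagon) (u : EuclideanSpace ℝ (Fin 3))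
    (hRu : ∀ r ∈ R, 0 < ⟪r, u⟫_ℝ) (ε : Bool)
    (hL : (L' : EuclideanSpace ℝ (Fin 3) → EuclideanSpace ℝ (Fin 3)) '' ↑fccSlots =
      (sigFrame ε : EuclideanSpace ℝ (Fin 3) → EuclideanSpace ℝ (Fin 3)) '' ↑fccSlots)
    (hax : L' (EuclideanSpace.single (2 : Fin 3) (1 : ℝ)) = EuclideanSpace.single (2 : Fin 3) (1 : ℝ) ∨
      L' (EuclideanSpace.single (2 : Fin 3) (1 : ℝ)) = -EuclideanSpace.single (2 : Fin 3) (1 : ℝ))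
    (hroot₁ : ∀ r ∈ R, ∀ κ : List (EuclideanSpace ℝ (Fin 3)), WFChain r κ →
      (((⟨L', R⟩ : PlateSystem).Fw κ : EuclideanSpace ℝ (Fin 3) → EuclideanSpace ℝ (Fin 3)) '' ↑fccSlots = ↑fccSlots ∨
        ((⟨L', R⟩ : PlateSystem).Fw κ : EuclideanSpace ℝ (Fin 3) → EuclideanSpace ℝ (Fin 3)) '' ↑fccSlots =
          (basalMirror : EuclideanSpace ℝ (Fin 3) → EuclideanSpace ℝ (Fin 3)) '' ↑fccSlots) → κ = [])
    (hroot₂ : ∀ r ∈ R, ∀ κ : List (EuclideanSpace ℝ (Fin 3)), WFChain r κ →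
      (((⟨((ℝ ∙ EuclideanSpace.single (2 : Fin 3) (1 : ℝ)).reflection).trans L', R⟩ : PlateSystem).Fw κ :
          EuclideanSpace ℝ (Fin 3) → EuclideanSpace ℝ (Fin 3)) '' ↑fccSlots = ↑fccSlots ∨
        ((⟨((ℝ ∙ EuclideanSpace.single (2 : Fin 3) (1 : ℝ)).reflection).trans L', R⟩ : PlateSystem).Fw κ :
          EuclideanSpace ℝ (Fin 3) → EuclideanSpace ℝ (Fin 3)) '' ↑fccSlots =
          (basalMirror : EuclideanSpace ℝ (Fin 3) → EuclideanSpace ℝ (Fin 3)) '' ↑fccSlots) → κ = []) :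
    ∃ h ∈ basalHexagon, ∀ b q : EuclideanSpace ℝ (Fin 3), dist (0 : EuclideanSpace ℝ (Fin 3)) b ≤ 1 →
      IsEndPairA Y v ⟨L', R⟩ ⟨((ℝ ∙ EuclideanSpace.single (2 : Fin 3) (1 : ℝ)).reflection).trans L', R⟩ b q →
      IsEndPairSig Y v (twinSigs ε h) b q := by
  classical
  set e₃ : EuclideanSpace ℝ (Fin 3) := EuclideanSpace.single (2 : Fin 3) (1 : ℝ) with he₃
  obtain ⟨h, hh, hsec⟩ := exists_sector_of_halfplane (L' u)
  refine ⟨h, hh, ?_⟩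
  have hRs : R ⊆ fccSlots := fun r hr => (mem_filter.1 (hR hr)).1
  -- root images are basal slots in the sector
  have hroot_img : ∀ r ∈ R, L' r ∈ fccSlots ∧ (L' r) 2 = 0 ∧ L' r ∈ basalSector h := by
    intro r hr
    obtain ⟨hrS, hr2⟩ := mem_filter.1 (hR hr)
    have key : ⟪L' r, L' e₃⟫_ℝ = 0 := by rw [LinearIsometryEquiv.inner_map_map, he₃, inner_single_two_one, hr2]
    have h2 : (L' r) 2 = 0 := by
      rw [← inner_single_two_one, ← he₃]
      rcases hax with hax | hax
      · rwa [hax] at key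
      · rw [hax, inner_neg_right] at key; linarith
    have hmem : L' r ∈ (L' : EuclideanSpace ℝ (Fin 3) → EuclideanSpace ℝ (Fin 3)) '' ↑fccSlots := ⟨r, mem_coe.2 hrS, rfl⟩
    rw [hL] at hmem
    obtain ⟨w₀, hw₀, heq⟩ := hmem
    have hw₀2 : w₀ 2 = 0 := by rw [← sigFrame_apply_two_eq_zero_iff ε, heq, h2]
    have hLr : L' r = w₀ := by rw [← heq, sigFrame_of_basal ε hw₀2]
    have hslot : L' r ∈ fccSlots := by rw [hLr]; exact mem_coe.1 hw₀
    refine ⟨hslot, h2, mem_filter.2 ⟨mem_filter.2 ⟨hslot, h2⟩, hsec _ (mem_filter.2 ⟨hslot, h2⟩) ?_⟩⟩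
    rw [LinearIsometryEquiv.inner_map_map]; exact hRu r hr
  -- the companion's slot dozen
  have hsymm : L'.symm e₃ = e₃ ∨ L'.symm e₃ = -e₃ := by
    rcases hax with hax | hax
    · left
      have := congrArg L'.symm hax
      rw [LinearIsometryEquiv.symm_apply_apply] at this
      exact this.symm
    · right
      have := congrArg L'.symm hax
      rw [LinearIsometryEquiv.symm_apply_apply, map_neg] at this
      rw [← neg_eq_iff_eq_neg]; exact this.symm
  have hcomm : ∀ x, basalMirror (L' x) = L' (basalMirror x) := by
    intro x
    rw [basalMirror_map, basalMirror_apply_eq]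
    rcases hsymm with hsy | hsy
    · rw [hsy]
    · rw [hsy, inner_neg_right, smul_neg, mul_neg, neg_smul, neg_neg]
  have himg₂ : ((((ℝ ∙ e₃).reflection).trans L' : EuclideanSpace ℝ (Fin 3) ≃ₗᵢ[ℝ] EuclideanSpace ℝ (Fin 3)) :
        EuclideanSpace ℝ (Fin 3) → EuclideanSpace ℝ (Fin 3)) '' ↑fccSlots =
      (sigFrame (!ε) : EuclideanSpace ℝ (Fin 3) → EuclideanSpace ℝ (Fin 3)) '' ↑fccSlots := by
    rw [← image_fccSlots_basalMirror_eq_halfTurn, image_sigFrame_not, ← hL, Set.image_image]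
    refine Set.image_congr fun x _ => ?_
    rw [LinearIsometryEquiv.trans_apply]
    change L' (basalMirror x) = _
    exact (hcomm x).symm
  intro b q hb hpair
  obtain ⟨hq, hbY, hpay, G, d, hadm, hqd, hmove⟩ := hpair
  have hstd := std_of_isEndPairA_menu hW hY (S₁ := ⟨L', R⟩) (S₂ := ⟨((ℝ ∙ e₃).reflection).trans L', R⟩) hRs hRs hb
    ⟨hq, hbY, hpay, G, d, hadm, hqd, hmove⟩ hmove
  rcases hadm with ⟨r, hr, κ, hκ, hG, hd⟩ | ⟨r, hr, κ, hκ, hG, hd⟩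
  · -- bottom root class: signature `(ε, L' r)`
    have hκ0 : κ = [] := hroot₁ r hr κ hκ (by rw [← hG]; exact hstd)
    subst hκ0
    obtain ⟨hslot, h2, hsecm⟩ := hroot_img r hr
    have hGL : G = L' := hG
    have hdd : d = L' r := by rw [hd]; simp [PlateSystem.Fw]
    have hsd : sigDir (ε, L' r) = d := by rw [sigDir, hdd]; exact sigFrame_of_basal ε h2
    have himg : (G : EuclideanSpace ℝ (Fin 3) → EuclideanSpace ℝ (Fin 3)) '' ↑fccSlots =
        (sigFrame ε : EuclideanSpace ℝ (Fin 3) → EuclideanSpace ℝ (Fin 3)) '' ↑fccSlots := by rw [hGL, hL]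
    refine ⟨hq, hbY, hpay, (ε, L' r), mem_union_left _ (mem_image.2 ⟨L' r, hsecm, rfl⟩), by rw [hsd]; exact hqd, ?_⟩
    rw [hsd]
    exact (isEndMove_congr himg v d q b).1 hmove
  · -- top root class: signature `(¬ε, −L' r)`
    have hκ0 : κ = [] := hroot₂ r hr κ hκ (by rw [← hG]; exact hstd)
    subst hκ0
    obtain ⟨hslot, h2, hsecm⟩ := hroot_img r hr
    obtain ⟨-, hr2⟩ := mem_filter.1 (hR hr)
    have hdd : d = -L' r := by
      rw [hd]; simp only [PlateSystem.Fw, List.length_nil, pow_zero, one_smul, LinearIsometryEquiv.trans_apply]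
      rw [halfTurn_of_basal hr2, map_neg]
    have h2' : (-L' r) 2 = 0 := by
      have : (-L' r) 2 = -((L' r) 2) := rfl
      rw [this, h2, neg_zero]
    have hsd : sigDir (!ε, -L' r) = d := by rw [sigDir, hdd]; exact sigFrame_of_basal (!ε) h2'
    have himg : (G : EuclideanSpace ℝ (Fin 3) → EuclideanSpace ℝ (Fin 3)) '' ↑fccSlots =
        (sigFrame (!ε) : EuclideanSpace ℝ (Fin 3) → EuclideanSpace ℝ (Fin 3)) '' ↑fccSlots := by rw [hG]; exact himg₂
    refine ⟨hq, hbY, hpay, (!ε, -L' r), mem_union_right _ (mem_image.2 ⟨L' r, hsecm, rfl⟩), by rw [hsd]; exact hqd, ?_⟩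
    rw [hsd]
    exact (isEndMove_congr himg v d q b).1 hmove

/-- **DOMINATION, TWIN SYSTEMS** (any base frame `L′`, basal roots in an open half-plane): some `transSigs ε n` or some
`twinSigs ε h` dominates. -/
theorem dominate_twin_menu (hW : ∀ q ∈ W, ∀ x ∈ W, dist q x = 1 →
      x - q ∈ fccSlots ∨ x - q ∈ (basalMirror : EuclideanSpace ℝ (Fin 3) → EuclideanSpace ℝ (Fin 3)) '' ↑fccSlots)
    (hY : ∀ x ∈ Y, dist (0 : EuclideanSpace ℝ (Fin 3)) x ≤ 3 → x ∈ W)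
    (L' : EuclideanSpace ℝ (Fin 3) ≃ₗᵢ[ℝ] EuclideanSpace ℝ (Fin 3)) (R : Finset (EuclideanSpace ℝ (Fin 3)))
    (hR : R ⊆ basalHexagon) (u : EuclideanSpace ℝ (Fin 3)) (hRu : ∀ r ∈ R, 0 < ⟪r, u⟫_ℝ) :
    (∃ ε : Bool, ∃ n ∈ modelNormals, ∀ b q : EuclideanSpace ℝ (Fin 3), dist (0 : EuclideanSpace ℝ (Fin 3)) b ≤ 1 →
      IsEndPairA Y v ⟨L', R⟩ ⟨((ℝ ∙ EuclideanSpace.single (2 : Fin 3) (1 : ℝ)).reflection).trans L', R⟩ b q →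
      IsEndPairSig Y v (transSigs ε n) b q) ∨
    (∃ ε : Bool, ∃ h ∈ basalHexagon, ∀ b q : EuclideanSpace ℝ (Fin 3), dist (0 : EuclideanSpace ℝ (Fin 3)) b ≤ 1 →
      IsEndPairA Y v ⟨L', R⟩ ⟨((ℝ ∙ EuclideanSpace.single (2 : Fin 3) (1 : ℝ)).reflection).trans L', R⟩ b q →
      IsEndPairSig Y v (twinSigs ε h) b q) := by
  classical
  set S₁ : PlateSystem := ⟨L', R⟩ with hS₁
  set S₂ : PlateSystem := ⟨((ℝ ∙ EuclideanSpace.single (2 : Fin 3) (1 : ℝ)).reflection).trans L', R⟩ with hS₂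
  have hR2 : ∀ r ∈ R, r 2 = 0 := fun r hr => (mem_filter.1 (hR hr)).2
  by_cases h₁ : ∃ r ∈ R, ∃ κ : List (EuclideanSpace ℝ (Fin 3)), WFChain r κ ∧
      ((S₁.Fw κ : EuclideanSpace ℝ (Fin 3) → EuclideanSpace ℝ (Fin 3)) '' ↑fccSlots = ↑fccSlots ∨
        (S₁.Fw κ : EuclideanSpace ℝ (Fin 3) → EuclideanSpace ℝ (Fin 3)) '' ↑fccSlots =
          (basalMirror : EuclideanSpace ℝ (Fin 3) → EuclideanSpace ℝ (Fin 3)) '' ↑fccSlots)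
  · by_cases h₂ : ∃ r ∈ R, ∃ κ : List (EuclideanSpace ℝ (Fin 3)), WFChain r κ ∧
        ((S₂.Fw κ : EuclideanSpace ℝ (Fin 3) → EuclideanSpace ℝ (Fin 3)) '' ↑fccSlots = ↑fccSlots ∨
          (S₂.Fw κ : EuclideanSpace ℝ (Fin 3) → EuclideanSpace ℝ (Fin 3)) '' ↑fccSlots =
            (basalMirror : EuclideanSpace ℝ (Fin 3) → EuclideanSpace ℝ (Fin 3)) '' ↑fccSlots)
    · -- both plates active: root classes only, standard basal-axis base frame, a twin row dominates
      right
      obtain ⟨r₁, hr₁, κ₁, hκ₁, hstd₁⟩ := h₁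
      obtain ⟨r₂, hr₂, κ₂, hκ₂, hstd₂⟩ := h₂
      obtain ⟨hκ₁0, -, hLstd, hax⟩ := twin_collapse L' R R (hR2 r₁ hr₁) hκ₁ hstd₁ (hR2 r₂ hr₂) hκ₂ hstd₂
      obtain ⟨ε, hL⟩ := exists_sigFrame_of_std hLstd
      obtain ⟨h, hh, hdom⟩ := dominate_twin_of_roots_menu hW hY L' R hR u hRu ε hL hax
        (fun r hr κ hκ hstd => (twin_collapse L' R R (hR2 r hr) hκ hstd (hR2 r₂ hr₂) hκ₂ hstd₂).1)
        (fun r hr κ hκ hstd => (twin_collapse L' R R (hR2 r₁ hr₁) hκ₁ hstd₁ (hR2 r hr) hκ hstd).2.1)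
      exact ⟨ε, h, hh, hdom⟩
    · -- only the bottom plate is active
      left
      obtain ⟨F, σ, hσ, hFstd, hcol⟩ := class_collapse S₁
      obtain ⟨ε, hF⟩ := exists_sigFrame_of_std hFstd
      obtain ⟨n, hn, hdom⟩ := dominate_of_collapse_menu hW hY S₁ S₂ hR hR ε F σ hσ hF (by
        rintro S (rfl | rfl) r hr κ hκ hstd
        · exact hcol r hr κ hκ hstd
        · exact absurd ⟨r, hr, κ, hκ, hstd⟩ h₂)
      exact ⟨ε, n, hn, hdom⟩
  · -- the bottom plate is not active: collapse the top one
    left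
    obtain ⟨F, σ, hσ, hFstd, hcol⟩ := class_collapse S₂
    obtain ⟨ε, hF⟩ := exists_sigFrame_of_std hFstd
    obtain ⟨n, hn, hdom⟩ := dominate_of_collapse_menu hW hY S₁ S₂ hR hR ε F σ hσ hF (by
      rintro S (rfl | rfl) r hr κ hκ hstd
      · exact absurd ⟨r, hr, κ, hκ, hstd⟩ h₁
      · exact hcol r hr κ hκ hstd)
    exact ⟨ε, n, hn, hdom⟩


end Dominate

/-! ### Packaging for the bridge -/

open scoped Classical in
/-- **Twin-row bound at a menu window** (half-turn form): some translation or twin signature row bounds the typed twin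
summand, for every frame `L`. -/
theorem exists_twinSig_bound_menu {v : WordVersion} {W : Set (EuclideanSpace ℝ (Fin 3))}
    (hW : ∀ q ∈ W, ∀ x ∈ W, dist q x = 1 →
      x - q ∈ fccSlots ∨ x - q ∈ (basalMirror : EuclideanSpace ℝ (Fin 3) → EuclideanSpace ℝ (Fin 3)) '' ↑fccSlots)
    {X P : Finset (EuclideanSpace ℝ (Fin 3))} {z : EuclideanSpace ℝ (Fin 3)}
    (S : EuclideanSpace ℝ (Fin 3) ≃ₗᵢ[ℝ] EuclideanSpace ℝ (Fin 3))
    (hagree : ∀ y, dist (0 : EuclideanSpace ℝ (Fin 3)) y ≤ 3 → (y ∈ X.image (fun x => S.symm x + -S.symm z) ↔ y ∈ P))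
    (hPW : ∀ p ∈ P, p ∈ W) (L : EuclideanSpace ℝ (Fin 3) ≃ₗᵢ[ℝ] EuclideanSpace ℝ (Fin 3)) :
    (∃ ε : Bool, ∃ n ∈ modelNormals,
      localSummandA v ⟨L, inPlaneRoots L 1⟩
        ⟨((ℝ ∙ EuclideanSpace.single (2 : Fin 3) (1 : ℝ)).reflection).trans L,
          inPlaneRoots (((ℝ ∙ EuclideanSpace.single (2 : Fin 3) (1 : ℝ)).reflection).trans L) (-1)⟩ X z ≤
        localStatSig P v (transSigs ε n) 0) ∨
    (∃ ε : Bool, ∃ h ∈ basalHexagon,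
      localSummandA v ⟨L, inPlaneRoots L 1⟩
        ⟨((ℝ ∙ EuclideanSpace.single (2 : Fin 3) (1 : ℝ)).reflection).trans L,
          inPlaneRoots (((ℝ ∙ EuclideanSpace.single (2 : Fin 3) (1 : ℝ)).reflection).trans L) (-1)⟩ X z ≤
        localStatSig P v (twinSigs ε h) 0) := by
  have hYW : ∀ x ∈ X.image (fun x => S.symm x + -S.symm z), dist (0 : EuclideanSpace ℝ (Fin 3)) x ≤ 3 → x ∈ W :=
    fun x hx hd => hPW x ((hagree x hd).1 hx)
  rw [inPlaneRoots_halfTurn]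
  have hRu : ∀ r ∈ inPlaneRoots L 1, 0 < ⟪r, L.symm (EuclideanSpace.single (2 : Fin 3) (1 : ℝ))⟫_ℝ := by
    intro r hr
    obtain ⟨-, -, hpos⟩ := mem_filter.1 hr
    rw [one_mul] at hpos
    rwa [← LinearIsometryEquiv.inner_map_map L, LinearIsometryEquiv.apply_symm_apply, inner_single_two_one]
  have hassoc : (((ℝ ∙ EuclideanSpace.single (2 : Fin 3) (1 : ℝ)).reflection).trans L).trans S.symm =
      ((ℝ ∙ EuclideanSpace.single (2 : Fin 3) (1 : ℝ)).reflection).trans (L.trans S.symm) :=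
    LinearIsometryEquiv.ext fun _ => rfl
  rcases dominate_twin_menu (v := v) hW hYW (L.trans S.symm) (inPlaneRoots L 1) (inPlaneRoots_subset_basalHexagon L 1)
      (L.symm (EuclideanSpace.single (2 : Fin 3) (1 : ℝ))) hRu with ⟨ε, n, hn, hdom⟩ | ⟨ε, h, hh, hdom⟩
  · rw [← hassoc] at hdom
    exact Or.inl ⟨ε, n, hn, localSummandA_le_localStatSig_window S hagree L _ _ _ (transSigs_slots ε n) hdom⟩
  · rw [← hassoc] at hdom
    exact Or.inr ⟨ε, h, hh, localSummandA_le_localStatSig_window S hagree L _ _ _ (twinSigs_slots ε h) hdom⟩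

end Summit.Ventures.Crystal3D.Theorems

end
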